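import Summits.QuantumFields.YangMills.Theorems.BalabanUVNodesN15TwoGridAdjoint
import Summits.QuantumFields.YangMills.Theorems.BalabanUVNodesN15DefectKernelAdjoint
import HarnessLib

/-!
# Route «BalabanUVNodes», node N15 = NE2, -a lane, part 64: THE L²-BLOCK TRANSFER CALCULUS — scalars, shifts, the box filter and its partial sums, the filter defect
# `(1 − a_ν)∇′_ν = −(L^m n′)⁻¹·b̃_ν∇′_ν∇′_ν`, and King's block average `R` (Jensen) — entry 2 of [B9] (3.42), fourth file

Cell `pub-ymgap`, seat `pub-ymgap-dag-n15-a` (KNIT-BY-NAME, g13); `--kind proof --supports stmt-QuantumFields-20507 --as helper`.  Over part 61 (`BlockNorm.l2Blocks`), part 63 (`ravg`), part 40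
(the sup-block transfer calculus this file mirrors: `blockOf_add_smul_unitVec_of_le`), part 34 (symbols), g2's `…N15DefectKernelAdjoint` (`card_fibre_kingProj`).
WHAT.  §88 `loc_l2Blocks_smul`, `hasMaj_smul_l2Blocks`; §89 ★ `loc_l2Blocks_shift_le` (a shift by `j ≤ n` fine steps moves L²-mass into at most the two blocks `B(y)`, `B(y + e_κ)`:
`loc(y, ρ(s_κ^j)g) ≤ loc(y, g) + loc(y + e_κ, g)`), `hasMajL2_sT_pow_comp` (`2e^{ρ}`), the backward twins, `hasMajL2_sA_comp`, `hasMajL2_sBt_comp`; §90 the FILTER DEFECT as a second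
difference: `one_sub_sA_mul_sD` (`(1 − a_ν)·c(s_ν−1) = −(cR)⁻¹·b̃_ν·(c(s_ν−1))²`), ★ `hasMajL2_one_sub_sA_sD_comp` (if `∇′_ν∇′_νT` has L² majorant `B e^{−ρd}` then `(1 − A_ν)∇′_νT` has
`((R−1)∕c)·e^{ρ}·B·e^{−ρd}` — at `R = L^m`, `c = n′`: `≤ η·e^{ρ}B`); §91 ★ `loc_l2Blocks_ravg_le` (JENSEN: `loc_{L²,η}(y, Rg) ≤ loc_{L²,η′}(y, g)`), `hasMajL2_ravg_comp`.
HONEST FRAMING ∕ LIMITS.  Finite-dimensional bookkeeping ([folklore]); NO estimate of [B5]∕[B9]; count-neutral (typed 28∕28 · discharged 5∕27 of record unchanged); NOT a discharge of N15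
(object-bound; NE2⁺ NOT PRINTED); one finite T⁴ at fixed ε — NOT infinite volume, NOT OS on ℝ⁴, NOT a mass gap, NOT Clay.
-/

noncomputable section

open scoped BigOperators
open Finset

namespace Summit.QuantumFields.YangMills.BalabanUVNodes.N15.TwoGrid

open Literature.MathematicalPhysics.QuantumFieldTheory.Balaban1983to89
open Literature.MathematicalPhysics.QuantumFieldTheory.Balaban1983to89.B11SectG (BlockNorm HasMaj hasMaj_zero)
open Literature.MathematicalPhysics.QuantumFieldTheory.Balaban1983to89.T4EtaRateCoeffDefect (pull pull_apply fibre mem_fibre)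
open Literature.MathematicalPhysics.QuantumFieldTheory.Balaban1983to89.B5Prop11Plancherel (Tor fine unitVec)
open Literature.MathematicalPhysics.QuantumFieldTheory.Balaban1983to89.B5SettingP12Weighted (etaPow etaPow_nonneg)
open Literature.MathematicalPhysics.QuantumFieldTheory.King1986.Torus (blockOf tdistT tdistT_nonneg tdistT_symm tdistT_triangle tdistT_sub_unitVec_le)
open Literature.MathematicalPhysics.QuantumFieldTheory.Balaban1983to89.B6UnitTorusCarrier (unitTorusGeo)
open Summit.QuantumFields.YangMills.BalabanUVNodes.N15.VectorPiece (blkFine blkFine_apply kingPr kingPrV kingPrV_eq kingPr_val blkFine_comp_kingPrV)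
open Summit.QuantumFields.YangMills.BalabanUVNodes.N15.DefectKernel (card_fibre_kingProj)

variable {d : ℕ}

/-! ## §88 Scalars -/

section Smul
variable {X : Type} [Fintype X] {g : B6.Geometry} [DecidableEq g.Site] {blk : X → g.Site} {w : ℝ}

/-- `loc_{L²}(y, c·f) = |c|·loc_{L²}(y, f)`. [folklore] -/
theorem loc_l2Blocks_smul (hw : 0 ≤ w) (y : g.Site) (c : ℝ) (f : X → ℝ) :
    (BlockNorm.l2Blocks g blk w hw).loc y (c • f) = |c| * (BlockNorm.l2Blocks g blk w hw).loc y f := by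
  rw [loc_l2Blocks_eq hw, loc_l2Blocks_eq hw]
  have e : ∑ x ∈ univ.filter (fun x => blk x = y), (c • f) x ^ 2 = c ^ 2 * ∑ x ∈ univ.filter (fun x => blk x = y), f x ^ 2 := by
    rw [mul_sum]; exact sum_congr rfl fun x _ => by rw [Pi.smul_apply, smul_eq_mul, mul_pow]
  rw [e, mul_left_comm, Real.sqrt_mul (sq_nonneg c), Real.sqrt_sq_eq_abs]

/-- scalar multiples into the L²-block norm: `c • T` has majorant `|c|·K`. [folklore] -/
theorem hasMaj_smul_l2Blocks {F₁ : Type} [AddCommGroup F₁] [Module ℝ F₁] {b₁ : BlockNorm g F₁} (hw : 0 ≤ w) {T : F₁ →ₗ[ℝ] (X → ℝ)}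
    {K : g.Site → g.Site → ℝ} (c : ℝ) (h : HasMaj b₁ (BlockNorm.l2Blocks g blk w hw) T K) :
    HasMaj b₁ (BlockNorm.l2Blocks g blk w hw) (c • T) (fun y y' => |c| * K y y') := by
  intro y' μ hμ y
  rw [LinearMap.smul_apply, loc_l2Blocks_smul hw, mul_assoc]
  exact mul_le_mul_of_nonneg_left (h y' μ hμ y) (abs_nonneg c)

end Smul

/-- `√(a + b) ≤ √a + √b` (`a, b ≥ 0`). [folklore] -/
private theorem sqrt_add_le_sqrt_add_sqrt {a b : ℝ} (ha : 0 ≤ a) (hb : 0 ≤ b) : Real.sqrt (a + b) ≤ Real.sqrt a + Real.sqrt b := by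
  rw [Real.sqrt_le_left (add_nonneg (Real.sqrt_nonneg a) (Real.sqrt_nonneg b))]
  nlinarith [Real.sq_sqrt ha, Real.sq_sqrt hb, Real.sqrt_nonneg a, Real.sqrt_nonneg b]

/-- `Σ_{s ∪ t} f ≤ Σ_s f + Σ_t f` for `f ≥ 0`. [folklore] -/
private theorem sum_union_le_add {ι : Type*} [DecidableEq ι] (s t : Finset ι) {f : ι → ℝ} (hf : ∀ i, 0 ≤ f i) :
    ∑ i ∈ s ∪ t, f i ≤ ∑ i ∈ s, f i + ∑ i ∈ t, f i := by
  have h := Finset.sum_union_inter (s₁ := s) (s₂ := t) (f := f)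
  have h0 : 0 ≤ ∑ i ∈ s ∩ t, f i := sum_nonneg fun i _ => hf i
  linarith

/-! ## §89 Shifts, the box filter and its partial sums in L²-block currency -/

section Shift
variable {L : ℕ} (M : Fin (d + 1) → ℕ) [∀ μ, NeZero (M μ)] (k n : ℕ) [NeZero n] {w : ℝ}

/-- ★ **A SHIFT BY `j ≤ n` FINE STEPS MOVES L²-MASS INTO AT MOST TWO BLOCKS**: `loc(y, ρ([v])g) ≤ loc(y, g) + loc(y + e_κ, g)` for `v = je_κ`, and `loc(y, ρ([−v])g) ≤ loc(y, g) + loc(y − e_κ, g)`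
— every `x ∈ B(y)` has `B(x + je_κ) ∈ {y, y + e_κ}` (part 40 `blockOf_add_smul_unitVec_of_le`) and the translation is injective. [folklore] -/
theorem loc_l2Blocks_shift_le (hw : 0 ≤ w) (κ : Fin (d + 1)) {j : ℕ} (hj : j ≤ n) (y : Tor M) (g : Tor (fine n M) × Fin (d + 1) → ℝ) :
    (BlockNorm.l2Blocks (unitTorusGeo L k M) (fun i : Tor (fine n M) × Fin (d + 1) => blockOf n M i.1) w hw).loc y
        (symbOp M n (AddMonoidAlgebra.single (j • unitVec (fine n M) κ) 1) g)
      ≤ (BlockNorm.l2Blocks (unitTorusGeo L k M) (fun i : Tor (fine n M) × Fin (d + 1) => blockOf n M i.1) w hw).loc y g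
        + (BlockNorm.l2Blocks (unitTorusGeo L k M) (fun i : Tor (fine n M) × Fin (d + 1) => blockOf n M i.1) w hw).loc (y + unitVec M κ) g := by
  classical
  set b := BlockNorm.l2Blocks (unitTorusGeo L k M) (fun i : Tor (fine n M) × Fin (d + 1) => blockOf n M i.1) w hw with hb
  set v : Tor (fine n M) := j • unitVec (fine n M) κ with hv
  -- the shifted block sum is a sum over the image of `B(y)` under `i ↦ (i.1 + v, i.2)`, which lies in `B(y) ∪ B(y + e_κ)`
  set e : (Tor (fine n M) × Fin (d + 1)) ↪ (Tor (fine n M) × Fin (d + 1)) :=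
    ⟨fun i => (i.1 + v, i.2), fun i i' h => by
      simp only [Prod.mk.injEq, add_left_inj] at h
      exact Prod.ext h.1 h.2⟩ with he
  have hsum : ∑ i ∈ univ.filter (fun i : Tor (fine n M) × Fin (d + 1) => blockOf n M i.1 = y),
      (symbOp M n (AddMonoidAlgebra.single v 1) g i) ^ 2
      = ∑ i ∈ (univ.filter (fun i : Tor (fine n M) × Fin (d + 1) => blockOf n M i.1 = y)).map e, g i ^ 2 := by
    rw [sum_map]
    exact sum_congr rfl fun i _ => by rw [symbOp_single_apply, one_mul]; rfl
  have hsub : (univ.filter (fun i : Tor (fine n M) × Fin (d + 1) => blockOf n M i.1 = y)).map e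
      ⊆ univ.filter (fun i : Tor (fine n M) × Fin (d + 1) => blockOf n M i.1 = y) ∪
        univ.filter (fun i : Tor (fine n M) × Fin (d + 1) => blockOf n M i.1 = y + unitVec M κ) := by
    intro i hi
    rw [mem_map] at hi
    obtain ⟨i₀, hi₀, rfl⟩ := hi
    rw [mem_filter] at hi₀
    obtain ⟨δ, hδ, hblk⟩ := blockOf_add_smul_unitVec_of_le M n i₀.1 κ hj
    rw [mem_union, mem_filter, mem_filter]
    simp only [he, Function.Embedding.coeFn_mk, mem_univ, true_and]
    rw [hblk, hi₀.2]
    interval_cases δ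
    · left; rw [zero_smul, add_zero]
    · right; rw [one_smul]
  have hS0 : ∀ s : Finset (Tor (fine n M) × Fin (d + 1)), 0 ≤ w * ∑ i ∈ s, g i ^ 2 := fun s => mul_nonneg hw (sum_nonneg fun _ _ => sq_nonneg _)
  rw [hb, loc_l2Blocks_eq hw, loc_l2Blocks_eq hw, loc_l2Blocks_eq hw, hsum]
  calc Real.sqrt (w * ∑ i ∈ (univ.filter (fun i : Tor (fine n M) × Fin (d + 1) => blockOf n M i.1 = y)).map e, g i ^ 2)
      ≤ Real.sqrt (w * ∑ i ∈ univ.filter (fun i : Tor (fine n M) × Fin (d + 1) => blockOf n M i.1 = y) ∪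
          univ.filter (fun i : Tor (fine n M) × Fin (d + 1) => blockOf n M i.1 = y + unitVec M κ), g i ^ 2) :=
        Real.sqrt_le_sqrt (mul_le_mul_of_nonneg_left (sum_le_sum_of_subset_of_nonneg hsub fun _ _ _ => sq_nonneg _) hw)
    _ ≤ Real.sqrt (w * ∑ i ∈ univ.filter (fun i : Tor (fine n M) × Fin (d + 1) => blockOf n M i.1 = y), g i ^ 2 +
          w * ∑ i ∈ univ.filter (fun i : Tor (fine n M) × Fin (d + 1) => blockOf n M i.1 = y + unitVec M κ), g i ^ 2) := by
        refine Real.sqrt_le_sqrt ?_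
        rw [← mul_add]
        exact mul_le_mul_of_nonneg_left (sum_union_le_add _ _ (fun _ => sq_nonneg _)) hw
    _ ≤ _ := sqrt_add_le_sqrt_add_sqrt (hS0 _) (hS0 _)

/-- the backward twin: `loc(y, ρ([−je_κ])g) ≤ loc(y, g) + loc(y − e_κ, g)`. [folklore] -/
theorem loc_l2Blocks_shift_neg_le (hw : 0 ≤ w) (κ : Fin (d + 1)) {j : ℕ} (hj : j ≤ n) (y : Tor M) (g : Tor (fine n M) × Fin (d + 1) → ℝ) :
    (BlockNorm.l2Blocks (unitTorusGeo L k M) (fun i : Tor (fine n M) × Fin (d + 1) => blockOf n M i.1) w hw).loc y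
        (symbOp M n (AddMonoidAlgebra.single (-(j • unitVec (fine n M) κ)) 1) g)
      ≤ (BlockNorm.l2Blocks (unitTorusGeo L k M) (fun i : Tor (fine n M) × Fin (d + 1) => blockOf n M i.1) w hw).loc y g
        + (BlockNorm.l2Blocks (unitTorusGeo L k M) (fun i : Tor (fine n M) × Fin (d + 1) => blockOf n M i.1) w hw).loc (y - unitVec M κ) g := by
  classical
  set b := BlockNorm.l2Blocks (unitTorusGeo L k M) (fun i : Tor (fine n M) × Fin (d + 1) => blockOf n M i.1) w hw with hb
  set v : Tor (fine n M) := j • unitVec (fine n M) κ with hv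
  set e : (Tor (fine n M) × Fin (d + 1)) ↪ (Tor (fine n M) × Fin (d + 1)) :=
    ⟨fun i => (i.1 + -v, i.2), fun i i' h => by
      simp only [Prod.mk.injEq, add_left_inj] at h
      exact Prod.ext h.1 h.2⟩ with he
  have hsum : ∑ i ∈ univ.filter (fun i : Tor (fine n M) × Fin (d + 1) => blockOf n M i.1 = y),
      (symbOp M n (AddMonoidAlgebra.single (-v) 1) g i) ^ 2
      = ∑ i ∈ (univ.filter (fun i : Tor (fine n M) × Fin (d + 1) => blockOf n M i.1 = y)).map e, g i ^ 2 := by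
    rw [sum_map]
    exact sum_congr rfl fun i _ => by rw [symbOp_single_apply, one_mul]; rfl
  have hsub : (univ.filter (fun i : Tor (fine n M) × Fin (d + 1) => blockOf n M i.1 = y)).map e
      ⊆ univ.filter (fun i : Tor (fine n M) × Fin (d + 1) => blockOf n M i.1 = y) ∪
        univ.filter (fun i : Tor (fine n M) × Fin (d + 1) => blockOf n M i.1 = y - unitVec M κ) := by
    intro i hi
    rw [mem_map] at hi
    obtain ⟨i₀, hi₀, rfl⟩ := hi
    rw [mem_filter] at hi₀
    -- `B(x − v) ∈ {B(x) − e, B(x)}`: apply the forward dichotomy at the point `x − v`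
    obtain ⟨δ, hδ, hblk⟩ := blockOf_add_smul_unitVec_of_le M n (i₀.1 + -v) κ hj
    rw [show i₀.1 + -v + j • unitVec (fine n M) κ = i₀.1 by rw [hv]; abel, hi₀.2] at hblk
    rw [mem_union, mem_filter, mem_filter]
    simp only [he, Function.Embedding.coeFn_mk, mem_univ, true_and]
    interval_cases δ
    · left; rw [zero_smul, add_zero] at hblk; exact hblk.symm
    · right; rw [one_smul] at hblk; rw [eq_sub_iff_add_eq]; exact hblk.symm
  have hS0 : ∀ s : Finset (Tor (fine n M) × Fin (d + 1)), 0 ≤ w * ∑ i ∈ s, g i ^ 2 := fun s => mul_nonneg hw (sum_nonneg fun _ _ => sq_nonneg _)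
  rw [hb, loc_l2Blocks_eq hw, loc_l2Blocks_eq hw, loc_l2Blocks_eq hw, hsum]
  calc Real.sqrt (w * ∑ i ∈ (univ.filter (fun i : Tor (fine n M) × Fin (d + 1) => blockOf n M i.1 = y)).map e, g i ^ 2)
      ≤ Real.sqrt (w * ∑ i ∈ univ.filter (fun i : Tor (fine n M) × Fin (d + 1) => blockOf n M i.1 = y) ∪
          univ.filter (fun i : Tor (fine n M) × Fin (d + 1) => blockOf n M i.1 = y - unitVec M κ), g i ^ 2) :=
        Real.sqrt_le_sqrt (mul_le_mul_of_nonneg_left (sum_le_sum_of_subset_of_nonneg hsub fun _ _ _ => sq_nonneg _) hw)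
    _ ≤ Real.sqrt (w * ∑ i ∈ univ.filter (fun i : Tor (fine n M) × Fin (d + 1) => blockOf n M i.1 = y), g i ^ 2 +
          w * ∑ i ∈ univ.filter (fun i : Tor (fine n M) × Fin (d + 1) => blockOf n M i.1 = y - unitVec M κ), g i ^ 2) := by
        refine Real.sqrt_le_sqrt ?_
        rw [← mul_add]
        exact mul_le_mul_of_nonneg_left (sum_union_le_add _ _ (fun _ => sq_nonneg _)) hw
    _ ≤ _ := sqrt_add_le_sqrt_add_sqrt (hS0 _) (hS0 _)

variable {F₁ : Type} [AddCommGroup F₁] [Module ℝ F₁]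

/-- ★ **A SHIFT BY `j ≤ n` FINE STEPS COSTS `2e^{ρ}` IN L²-BLOCK CURRENCY**. [folklore] -/
theorem hasMajL2_sT_pow_comp (hw : 0 ≤ w) {b₁ : BlockNorm (unitTorusGeo L k M) F₁} {T : F₁ →ₗ[ℝ] (Tor (fine n M) × Fin (d + 1) → ℝ)} {B ρ : ℝ}
    (hB : 0 ≤ B) (hρ : 0 ≤ ρ) (κ : Fin (d + 1)) {j : ℕ} (hj : j ≤ n)
    (h : HasMaj b₁ (BlockNorm.l2Blocks (unitTorusGeo L k M) (fun i : Tor (fine n M) × Fin (d + 1) => blockOf n M i.1) w hw) T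
      (fun y y' => B * Real.exp (-(ρ * tdistT M y y')))) :
    HasMaj b₁ (BlockNorm.l2Blocks (unitTorusGeo L k M) (fun i : Tor (fine n M) × Fin (d + 1) => blockOf n M i.1) w hw) (symbOp M n (sT M n κ ^ j) ∘ₗ T)
      (fun y y' => 2 * B * Real.exp ρ * Real.exp (-(ρ * tdistT M y y'))) := by
  intro y' μ hμ y
  rw [LinearMap.comp_apply, sT_pow]
  refine (loc_l2Blocks_shift_le M k n hw κ hj y (T μ)).trans ?_
  have h1 := h y' μ hμ y
  have h2 := h y' μ hμ (y + unitVec M κ)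
  have hstep : tdistT M y y' ≤ tdistT M (y + unitVec M κ) y' + 1 := by
    have ht := tdistT_triangle M y (y + unitVec M κ) y'
    have hs : tdistT M y (y + unitVec M κ) ≤ 1 := by
      have := tdistT_sub_unitVec_le M (y + unitVec M κ) κ
      rwa [add_sub_cancel_right, tdistT_symm] at this
    linarith
  have hexp : Real.exp (-(ρ * tdistT M (y + unitVec M κ) y')) ≤ Real.exp ρ * Real.exp (-(ρ * tdistT M y y')) := by
    rw [← Real.exp_add]; exact Real.exp_le_exp.mpr (by nlinarith)
  have he1 : 1 ≤ Real.exp ρ := Real.one_le_exp hρ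
  have hl0 := b₁.loc_nonneg y' μ
  have hE := Real.exp_nonneg (-(ρ * tdistT M y y'))
  calc _ ≤ B * Real.exp (-(ρ * tdistT M y y')) * b₁.loc y' μ + B * Real.exp (-(ρ * tdistT M (y + unitVec M κ) y')) * b₁.loc y' μ := add_le_add h1 h2
    _ ≤ B * Real.exp ρ * Real.exp (-(ρ * tdistT M y y')) * b₁.loc y' μ + B * (Real.exp ρ * Real.exp (-(ρ * tdistT M y y'))) * b₁.loc y' μ :=
        add_le_add (mul_le_mul_of_nonneg_right (mul_le_mul_of_nonneg_right (le_mul_of_one_le_right hB he1) hE) hl0)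
          (mul_le_mul_of_nonneg_right (mul_le_mul_of_nonneg_left hexp hB) hl0)
    _ = _ := by ring

/-- the backward shift `ρ(s_κ^{−j})`, `j ≤ n`: `2e^{ρ}`. [folklore] -/
theorem hasMajL2_sTinv_pow_comp (hw : 0 ≤ w) {b₁ : BlockNorm (unitTorusGeo L k M) F₁} {T : F₁ →ₗ[ℝ] (Tor (fine n M) × Fin (d + 1) → ℝ)} {B ρ : ℝ}
    (hB : 0 ≤ B) (hρ : 0 ≤ ρ) (κ : Fin (d + 1)) {j : ℕ} (hj : j ≤ n)
    (h : HasMaj b₁ (BlockNorm.l2Blocks (unitTorusGeo L k M) (fun i : Tor (fine n M) × Fin (d + 1) => blockOf n M i.1) w hw) T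
      (fun y y' => B * Real.exp (-(ρ * tdistT M y y')))) :
    HasMaj b₁ (BlockNorm.l2Blocks (unitTorusGeo L k M) (fun i : Tor (fine n M) × Fin (d + 1) => blockOf n M i.1) w hw) (symbOp M n (sTinv M n κ ^ j) ∘ₗ T)
      (fun y y' => 2 * B * Real.exp ρ * Real.exp (-(ρ * tdistT M y y'))) := by
  intro y' μ hμ y
  rw [LinearMap.comp_apply, sTinv_pow]
  refine (loc_l2Blocks_shift_neg_le M k n hw κ hj y (T μ)).trans ?_
  have h1 := h y' μ hμ y
  have h2 := h y' μ hμ (y - unitVec M κ)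
  have hstep : tdistT M y y' ≤ tdistT M (y - unitVec M κ) y' + 1 := by
    have ht := tdistT_triangle M y (y - unitVec M κ) y'
    have hs : tdistT M y (y - unitVec M κ) ≤ 1 := tdistT_sub_unitVec_le M y κ
    linarith
  have hexp : Real.exp (-(ρ * tdistT M (y - unitVec M κ) y')) ≤ Real.exp ρ * Real.exp (-(ρ * tdistT M y y')) := by
    rw [← Real.exp_add]; exact Real.exp_le_exp.mpr (by nlinarith)
  have he1 : 1 ≤ Real.exp ρ := Real.one_le_exp hρ
  have hl0 := b₁.loc_nonneg y' μ
  have hE := Real.exp_nonneg (-(ρ * tdistT M y y'))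
  calc _ ≤ B * Real.exp (-(ρ * tdistT M y y')) * b₁.loc y' μ + B * Real.exp (-(ρ * tdistT M (y - unitVec M κ) y')) * b₁.loc y' μ := add_le_add h1 h2
    _ ≤ B * Real.exp ρ * Real.exp (-(ρ * tdistT M y y')) * b₁.loc y' μ + B * (Real.exp ρ * Real.exp (-(ρ * tdistT M y y'))) * b₁.loc y' μ :=
        add_le_add (mul_le_mul_of_nonneg_right (mul_le_mul_of_nonneg_right (le_mul_of_one_le_right hB he1) hE) hl0)
          (mul_le_mul_of_nonneg_right (mul_le_mul_of_nonneg_left hexp hB) hl0)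
    _ = _ := by ring

/-- finite sums of operators into the L²-block norm (the `BlockNorm`-generic `hasMaj_finsum` of part 40, recalled for convenience). [folklore] -/
theorem hasMajL2_finsum (hw : 0 ≤ w) {b₁ : BlockNorm (unitTorusGeo L k M) F₁} {ι : Type} (s : Finset ι) (T : ι → F₁ →ₗ[ℝ] (Tor (fine n M) × Fin (d + 1) → ℝ))
    (K : ι → Tor M → Tor M → ℝ)
    (h : ∀ i ∈ s, HasMaj b₁ (BlockNorm.l2Blocks (unitTorusGeo L k M) (fun i : Tor (fine n M) × Fin (d + 1) => blockOf n M i.1) w hw) (T i) (K i)) :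
    HasMaj b₁ (BlockNorm.l2Blocks (unitTorusGeo L k M) (fun i : Tor (fine n M) × Fin (d + 1) => blockOf n M i.1) w hw) (∑ i ∈ s, T i) (fun a c => ∑ i ∈ s, K i a c) :=
  hasMaj_finsum (g := unitTorusGeo L k M) s T K h

/-- **THE BOX FILTER `ρ(a_κ(R))`, `R ≤ n`: `2e^{ρ}`** (average of shifts). [folklore] -/
theorem hasMajL2_sA_comp (hw : 0 ≤ w) {b₁ : BlockNorm (unitTorusGeo L k M) F₁} {T : F₁ →ₗ[ℝ] (Tor (fine n M) × Fin (d + 1) → ℝ)} {B ρ : ℝ}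
    (hB : 0 ≤ B) (hρ : 0 ≤ ρ) (κ : Fin (d + 1)) {R : ℕ} (hR : R ≠ 0) (hRn : R ≤ n)
    (h : HasMaj b₁ (BlockNorm.l2Blocks (unitTorusGeo L k M) (fun i : Tor (fine n M) × Fin (d + 1) => blockOf n M i.1) w hw) T
      (fun y y' => B * Real.exp (-(ρ * tdistT M y y')))) :
    HasMaj b₁ (BlockNorm.l2Blocks (unitTorusGeo L k M) (fun i : Tor (fine n M) × Fin (d + 1) => blockOf n M i.1) w hw) (symbOp M n (sA M n κ R) ∘ₗ T)
      (fun y y' => 2 * B * Real.exp ρ * Real.exp (-(ρ * tdistT M y y'))) := by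
  have hR' : (0 : ℝ) < R := by exact_mod_cast Nat.pos_of_ne_zero hR
  rw [sA, map_smul, map_sum, LinearMap.smul_comp]
  have h1 : ∀ j ∈ range R, HasMaj b₁ (BlockNorm.l2Blocks (unitTorusGeo L k M) (fun i : Tor (fine n M) × Fin (d + 1) => blockOf n M i.1) w hw)
      (symbOp M n (sT M n κ ^ j) ∘ₗ T) (fun y y' => 2 * B * Real.exp ρ * Real.exp (-(ρ * tdistT M y y'))) :=
    fun j hj => hasMajL2_sT_pow_comp M k n hw hB hρ κ ((mem_range.mp hj).le.trans hRn) h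
  have hsum := hasMajL2_finsum M k n hw (b₁ := b₁) (range R) (fun j => symbOp M n (sT M n κ ^ j) ∘ₗ T) (fun _ y y' => 2 * B * Real.exp ρ * Real.exp (-(ρ * tdistT M y y'))) h1
  refine ((hasMaj_smul_l2Blocks hw ((R : ℝ)⁻¹) (hsum.congr fun μ => ?_)).mono fun y y' => le_of_eq ?_)
  · simp only [LinearMap.sum_apply, LinearMap.comp_apply]
  · rw [sum_const, card_range, nsmul_eq_mul, abs_inv, Nat.abs_cast, ← mul_assoc, inv_mul_cancel₀ hR'.ne', one_mul]

/-- **THE PARTIAL SUMS `ρ(b̃_κ(R))`, `R ≤ n`: `(R(R−1)∕2)·2e^{ρ}`**. [folklore] -/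
theorem hasMajL2_sBt_comp (hw : 0 ≤ w) {b₁ : BlockNorm (unitTorusGeo L k M) F₁} {T : F₁ →ₗ[ℝ] (Tor (fine n M) × Fin (d + 1) → ℝ)} {B ρ : ℝ}
    (hB : 0 ≤ B) (hρ : 0 ≤ ρ) (κ : Fin (d + 1)) {R : ℕ} (hRn : R ≤ n)
    (h : HasMaj b₁ (BlockNorm.l2Blocks (unitTorusGeo L k M) (fun i : Tor (fine n M) × Fin (d + 1) => blockOf n M i.1) w hw) T
      (fun y y' => B * Real.exp (-(ρ * tdistT M y y')))) :
    HasMaj b₁ (BlockNorm.l2Blocks (unitTorusGeo L k M) (fun i : Tor (fine n M) × Fin (d + 1) => blockOf n M i.1) w hw) (symbOp M n (sBt M n κ R) ∘ₗ T)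
      (fun y y' => (R : ℝ) * ((R : ℝ) - 1) / 2 * (2 * B * Real.exp ρ * Real.exp (-(ρ * tdistT M y y')))) := by
  rw [sBt, map_sum]
  have h1 : ∀ j ∈ range R, HasMaj b₁ (BlockNorm.l2Blocks (unitTorusGeo L k M) (fun i : Tor (fine n M) × Fin (d + 1) => blockOf n M i.1) w hw)
      (symbOp M n (∑ i ∈ range j, sT M n κ ^ i) ∘ₗ T) (fun y y' => (j : ℝ) * (2 * B * Real.exp ρ * Real.exp (-(ρ * tdistT M y y')))) := by
    intro j hj
    rw [map_sum]
    have h2 : ∀ i ∈ range j, HasMaj b₁ (BlockNorm.l2Blocks (unitTorusGeo L k M) (fun i : Tor (fine n M) × Fin (d + 1) => blockOf n M i.1) w hw)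
        (symbOp M n (sT M n κ ^ i) ∘ₗ T) (fun y y' => 2 * B * Real.exp ρ * Real.exp (-(ρ * tdistT M y y'))) :=
      fun i hi => hasMajL2_sT_pow_comp M k n hw hB hρ κ (((mem_range.mp hi).le.trans (mem_range.mp hj).le).trans hRn) h
    have hs := hasMajL2_finsum M k n hw (b₁ := b₁) (range j) (fun i => symbOp M n (sT M n κ ^ i) ∘ₗ T) (fun _ y y' => 2 * B * Real.exp ρ * Real.exp (-(ρ * tdistT M y y'))) h2
    refine (hs.congr fun μ => ?_).mono fun y y' => le_of_eq ?_
    · simp only [LinearMap.sum_apply, LinearMap.comp_apply]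
    · rw [sum_const, card_range, nsmul_eq_mul]
  have hs := hasMajL2_finsum M k n hw (b₁ := b₁) (range R) (fun j => symbOp M n (∑ i ∈ range j, sT M n κ ^ i) ∘ₗ T)
    (fun j y y' => (j : ℝ) * (2 * B * Real.exp ρ * Real.exp (-(ρ * tdistT M y y')))) h1
  refine (hs.congr fun μ => ?_).mono fun y y' => le_of_eq ?_
  · simp only [LinearMap.sum_apply, LinearMap.comp_apply]
  · rw [← sum_mul, sum_range_cast_eq]

end Shift

/-! ## §90 The filter defect `(1 − a_ν)∇′_ν` is `η` times a second difference -/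

section FilterDefect
variable {L : ℕ} (M : Fin (d + 1) → ℕ) [∀ μ, NeZero (M μ)] (k n : ℕ) [NeZero n] {w : ℝ} {F₁ : Type} [AddCommGroup F₁] [Module ℝ F₁]

omit [∀ μ, NeZero (M μ)] [NeZero n] in
/-- **`(1 − a_ν)·c(s_ν−1) = −(cR)⁻¹·b̃_ν·(c(s_ν−1))²`** (`R ≠ 0`, `c ≠ 0`): the filter defect of a difference quotient is a second difference quotient times the `O(R²)` partial sums and
the small factor `(cR)⁻¹` (at `R = L^m`, `c = n′`: `R(R−1)∕2 · (cR)⁻¹ ≤ (2n)⁻¹ = η∕2`). [folklore] -/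
theorem one_sub_sA_mul_sD (κ : Fin (d + 1)) {R : ℕ} (hR : R ≠ 0) {c : ℝ} (hc : c ≠ 0) :
    (1 - sA M n κ R) * sD M n κ c = -((c * R)⁻¹ • (sBt M n κ R * sD M n κ c * sD M n κ c)) := by
  rw [one_sub_sA M n κ hR]
  have e : sT M n κ - 1 = c⁻¹ • sD M n κ c := by rw [sD, smul_smul, inv_mul_cancel₀ hc, one_smul]
  rw [e, mul_inv]
  simp only [Algebra.smul_def, map_mul]
  ring

/-- ★ **THE FILTER DEFECT IN L²-BLOCK CURRENCY**: if `ρ(c(s_ν−1))∘ρ(c(s_ν−1))∘T` (`∇′_ν∇′_νT`) has the L² majorant `B·e^{−ρd}` then `ρ(1 − a_ν(R))∘ρ(c(s_ν−1))∘T` has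
`((R−1)∕c)·e^{ρ}·B·e^{−ρd}` (`R ≤ n`, `c > 0`). [folklore] -/
theorem hasMajL2_one_sub_sA_sD_comp (hw : 0 ≤ w) {b₁ : BlockNorm (unitTorusGeo L k M) F₁} {T : F₁ →ₗ[ℝ] (Tor (fine n M) × Fin (d + 1) → ℝ)} {B ρ : ℝ}
    (hB : 0 ≤ B) (hρ : 0 ≤ ρ) (κ : Fin (d + 1)) {R : ℕ} (hR : R ≠ 0) (hRn : R ≤ n) {c : ℝ} (hc : 0 < c)
    (h : HasMaj b₁ (BlockNorm.l2Blocks (unitTorusGeo L k M) (fun i : Tor (fine n M) × Fin (d + 1) => blockOf n M i.1) w hw)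
      (symbOp M n (sD M n κ c) ∘ₗ symbOp M n (sD M n κ c) ∘ₗ T) (fun y y' => B * Real.exp (-(ρ * tdistT M y y')))) :
    HasMaj b₁ (BlockNorm.l2Blocks (unitTorusGeo L k M) (fun i : Tor (fine n M) × Fin (d + 1) => blockOf n M i.1) w hw)
      (symbOp M n (1 - sA M n κ R) ∘ₗ symbOp M n (sD M n κ c) ∘ₗ T) (fun y y' => (((R : ℝ) - 1) / c) * Real.exp ρ * B * Real.exp (-(ρ * tdistT M y y'))) := by
  have hR' : (0 : ℝ) < R := by exact_mod_cast Nat.pos_of_ne_zero hR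
  have hop : symbOp M n (1 - sA M n κ R) ∘ₗ symbOp M n (sD M n κ c) ∘ₗ T = -((c * R)⁻¹ • (symbOp M n (sBt M n κ R) ∘ₗ (symbOp M n (sD M n κ c) ∘ₗ symbOp M n (sD M n κ c) ∘ₗ T))) := by
    rw [← LinearMap.comp_assoc, ← Module.End.mul_eq_comp, ← map_mul, one_sub_sA_mul_sD M n κ hR hc.ne', map_neg, map_smul, map_mul, map_mul, LinearMap.neg_comp,
      LinearMap.smul_comp, Module.End.mul_eq_comp, Module.End.mul_eq_comp, LinearMap.comp_assoc, LinearMap.comp_assoc]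
  rw [hop]
  have hbt := hasMajL2_sBt_comp M k n hw hB hρ κ hRn h
  refine ((hasMaj_smul_l2Blocks hw ((c * R)⁻¹) hbt).neg).mono fun y y' => le_of_eq ?_
  rw [abs_inv, abs_of_pos (mul_pos hc hR')]
  field_simp

end FilterDefect

/-! ## §91 King's block average is an L²-contraction blockwise (Jensen) -/

section Ravg
variable {L : ℕ} [NeZero L] (M : Fin (d + 1) → ℕ) [∀ μ, NeZero (M μ)] (k m : ℕ)

/-- ★ **JENSEN FOR THE BLOCK AVERAGE**: `loc_{L², η^{d+1}}(y, Rg) ≤ loc_{L², η′^{d+1}}(y, g)` — `(Rg)(x)² ≤ L^{−m(d+1)}Σ_{B_m(x)} g²` (Cauchy–Schwarz, `#B_m(x) = L^{m(d+1)}`), and the `m`-blocks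
of the coarse points of `B(y)` tile the fine block `B(y)`; the weights match: `η^{d+1}·L^{−m(d+1)} = η′^{d+1}`. [folklore] -/
theorem loc_l2Blocks_ravg_le (y : Tor M) (g : Tor (fine (L ^ m * L ^ k) M) × Fin (d + 1) → ℝ) :
    (BlockNorm.l2Blocks (unitTorusGeo L k M) (blkFine L k M) (etaPow (L ^ k) (d + 1)) (etaPow_nonneg _ _)).loc y (ravg M L k m g)
      ≤ (BlockNorm.l2Blocks (unitTorusGeo L k M) (fun i : Tor (fine (L ^ m * L ^ k) M) × Fin (d + 1) => blockOf (L ^ m * L ^ k) M i.1)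
          (etaPow (L ^ m * L ^ k) (d + 1)) (etaPow_nonneg _ _)).loc y g := by
  classical
  have hL : (0 : ℝ) < L := by exact_mod_cast Nat.pos_of_ne_zero (NeZero.ne L)
  have hLm : (0 : ℝ) < ((L : ℝ) ^ m) ^ (d + 1) := by positivity
  rw [loc_l2Blocks_eq, loc_l2Blocks_eq]
  refine Real.sqrt_le_sqrt ?_
  -- weights
  have hw : etaPow (L ^ m * L ^ k) (d + 1) = etaPow (L ^ k) (d + 1) * (((L : ℝ) ^ m) ^ (d + 1))⁻¹ := by
    unfold etaPow
    rw [← inv_pow, ← mul_pow, ← mul_inv]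
    congr 2
    push_cast; ring
  rw [hw, mul_assoc]
  refine mul_le_mul_of_nonneg_left ?_ (etaPow_nonneg _ _)
  -- Cauchy–Schwarz per coarse bond, then the fibres tile the fine block
  have hcard : ∀ x : Tor (fine (L ^ k) M), ((fibre (kingPr L k m M) x).card : ℝ) = ((L : ℝ) ^ m) ^ (d + 1) := fun x => by
    rw [card_fibre_kingProj L k m M (kingPr L k m M) (fun x' μ => kingPr_val L k m M x' μ) x]; push_cast; ring
  have hpt : ∀ i : Tor (fine (L ^ k) M) × Fin (d + 1), ravg M L k m g i ^ 2 ≤ (((L : ℝ) ^ m) ^ (d + 1))⁻¹ * ∑ x' ∈ fibre (kingPr L k m M) i.1, g (x', i.2) ^ 2 := by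
    intro i
    rw [ravg_apply, mul_pow]
    have hCS : (∑ x' ∈ fibre (kingPr L k m M) i.1, g (x', i.2)) ^ 2 ≤ ((fibre (kingPr L k m M) i.1).card : ℝ) * ∑ x' ∈ fibre (kingPr L k m M) i.1, g (x', i.2) ^ 2 :=
      sq_sum_le_card_mul_sum_sq (s := fibre (kingPr L k m M) i.1) (f := fun x' => g (x', i.2))
    rw [hcard] at hCS
    calc ((((L : ℝ) ^ m) ^ (d + 1))⁻¹) ^ 2 * (∑ x' ∈ fibre (kingPr L k m M) i.1, g (x', i.2)) ^ 2
        ≤ ((((L : ℝ) ^ m) ^ (d + 1))⁻¹) ^ 2 * ((((L : ℝ) ^ m) ^ (d + 1)) * ∑ x' ∈ fibre (kingPr L k m M) i.1, g (x', i.2) ^ 2) :=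
          mul_le_mul_of_nonneg_left hCS (sq_nonneg _)
      _ = _ := by field_simp
  calc ∑ i ∈ univ.filter (fun i : Tor (fine (L ^ k) M) × Fin (d + 1) => blkFine L k M i = y), ravg M L k m g i ^ 2
      ≤ ∑ i ∈ univ.filter (fun i : Tor (fine (L ^ k) M) × Fin (d + 1) => blkFine L k M i = y), (((L : ℝ) ^ m) ^ (d + 1))⁻¹ * ∑ x' ∈ fibre (kingPr L k m M) i.1, g (x', i.2) ^ 2 :=
        sum_le_sum fun i _ => hpt i
    _ = (((L : ℝ) ^ m) ^ (d + 1))⁻¹ * ∑ i ∈ univ.filter (fun i : Tor (fine (L ^ k) M) × Fin (d + 1) => blkFine L k M i = y), ∑ x' ∈ fibre (kingPr L k m M) i.1, g (x', i.2) ^ 2 := by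
        rw [mul_sum]
    _ = (((L : ℝ) ^ m) ^ (d + 1))⁻¹ * ∑ i' ∈ univ.filter (fun i' : Tor (fine (L ^ m * L ^ k) M) × Fin (d + 1) => blockOf (L ^ m * L ^ k) M i'.1 = y), g i' ^ 2 := by
        congr 1
        -- both sides are `Σ_{i′ : B′(i′) = y} g(i′)²`, grouped by the coarse bond `kingPrV i′`
        have hfib : ∀ i' : Tor (fine (L ^ m * L ^ k) M) × Fin (d + 1), blockOf (L ^ m * L ^ k) M i'.1 = blkFine L k M (kingPrV L k m M i') := fun i' =>
          (congrFun (blkFine_comp_kingPrV M L k m) i').symm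
        rw [← Finset.sum_fiberwise_of_maps_to (s := univ.filter (fun i' : Tor (fine (L ^ m * L ^ k) M) × Fin (d + 1) => blockOf (L ^ m * L ^ k) M i'.1 = y))
          (t := univ.filter (fun i : Tor (fine (L ^ k) M) × Fin (d + 1) => blkFine L k M i = y)) (g := kingPrV L k m M)
          (fun i' hi' => by rw [mem_filter] at hi' ⊢; exact ⟨mem_univ _, by rw [← hfib]; exact hi'.2⟩)]
        refine sum_congr rfl fun i hi => ?_
        rw [mem_filter] at hi
        -- the fibre of `kingPrV` over the bond `i = (x, κ)` inside `B′ = y` is `(fibre kingPr x) × {κ}`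
        have hset : (univ.filter (fun i' : Tor (fine (L ^ m * L ^ k) M) × Fin (d + 1) => blockOf (L ^ m * L ^ k) M i'.1 = y)).filter
            (fun i' => kingPrV L k m M i' = i) = (fibre (kingPr L k m M) i.1).map ⟨fun x' => (x', i.2), fun a b h => (Prod.ext_iff.mp h).1⟩ := by
          ext ⟨x', κ⟩
          simp only [mem_filter, mem_univ, true_and, mem_map, mem_fibre, Function.Embedding.coeFn_mk, Prod.mk.injEq, kingPrV_eq]
          constructor
          · rintro ⟨-, h⟩
            exact ⟨x', (Prod.ext_iff.mp h).1, rfl, ((Prod.ext_iff.mp h).2).symm⟩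
          · rintro ⟨x'', hx'', rfl, rfl⟩
            refine ⟨?_, Prod.ext hx'' rfl⟩
            have hb := hfib (x'', i.2)
            simp only [kingPrV_eq] at hb
            rw [hb, blkFine_apply]
            simp only
            rw [hx'', ← blkFine_apply]
            exact hi.2
        rw [hset, sum_map]
        rfl

/-- `R∘T` keeps an (· → L²) majorant of `T` (fine blocks ↦ coarse blocks, matching weights). [folklore] -/
theorem hasMajL2_ravg_comp {F₁ : Type} [AddCommGroup F₁] [Module ℝ F₁] {b₁ : BlockNorm (unitTorusGeo L k M) F₁}
    {T : F₁ →ₗ[ℝ] (Tor (fine (L ^ m * L ^ k) M) × Fin (d + 1) → ℝ)} {K : Tor M → Tor M → ℝ}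
    (h : HasMaj b₁ (BlockNorm.l2Blocks (unitTorusGeo L k M) (fun i : Tor (fine (L ^ m * L ^ k) M) × Fin (d + 1) => blockOf (L ^ m * L ^ k) M i.1)
      (etaPow (L ^ m * L ^ k) (d + 1)) (etaPow_nonneg _ _)) T K) :
    HasMaj b₁ (BlockNorm.l2Blocks (unitTorusGeo L k M) (blkFine L k M) (etaPow (L ^ k) (d + 1)) (etaPow_nonneg _ _)) (ravg M L k m ∘ₗ T) K := by
  intro y' μ hμ y
  rw [LinearMap.comp_apply]
  exact (loc_l2Blocks_ravg_le M k m y (T μ)).trans (h y' μ hμ y)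

end Ravg

end Summit.QuantumFields.YangMills.BalabanUVNodes.N15.TwoGrid
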